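import Summits.HodgeConjecture.CorCM.Census.CyclicCharacterEvenParityHalf

/-!
# Cyclic characters, XXXIII: EVEN KERNEL, toward `d = 0` — ζ CLOSES THE LATTICE MODULO DOUBLING (`k = 2`)

COR-CM (cell `pub-hodgecm2`), count-neutral kernel combinatorics by the binder seat b09 (gen 43; lane CYCLIC-CHARACTER FIBRE LAW, part XXXIII), on parts XVI
(`hodgeSpan_le_psp_cover_union`), XIX (`shift_mem_of_zeta_mem`), XXXII (`fibreConst_mem_of_nonroot`) BY NAME.  Theorems only (no definition, no `decide`, no
certificate, no named fact, no `sorry`).  HONEST FRAMING: `HC_CM` is NOT proved, here or anywhere in the tree; nothing here is a period or a headline.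

**THEOREM (`hodgeSpan_le_of_zeta_of_two_smul`, `k = 2`).**  Let `L = ℤ⟨pairs⟩ + ℤ[G]·S` (`S ⊆ hodgeSpan`) reduce every type to potential `≤ 1`, contain `ζ_s`
for every bottom `s`, and contain `2·hodgeSpan`.  If `d = 0` and `|F_0|` is even, then `hodgeSpan ≤ L`.
With part XXXIʼs ζ-certificate (`β − 2 = φ₂` faces) this is the `d = 0` law for `k = 2` MODULO the doubling hypothesis `2·hodgeSpan ⊆ L` — numerically true in
every row (`HOME/pub-hodgecm2-b09/lean-g43/py/d0index.py`: `[hodgeSpan : L] ∈ {1, 2}` always) but OPEN (`EVEN-KERNEL-ROADMAP.md`).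

PROOF (nilpotency of `g − 1` mod `2`).  (1) `hodgeSpan = L + ℤ[G]·K` (part XVI with the shifts from `ζ`, and `(W2) = K + Σ ζ`); (2) `K·ν = K` for kernel `ν`, so
kernel coboundaries of Hodge vectors lie in `L`; (3) `K ∈ L + T(hodgeSpan)` with `T = (·)·g − 1`, `w g = 1` (part XXXII: `K` = pairs + face coboundaries +
`2·`Hodge; a coboundary along `Q = ν gⁱ` is a kernel coboundary plus a telescoping sum of `T`-values); (4) hence `hodgeSpan ⊆ L + T^i(hodgeSpan)` for all `i`, and
`T^{2^j} ≡ T_{g^{2^j}}` modulo `L` (`T_u² = T_{u²} − 2T_u`); at `j = k`, `g^{2ᵏ}` is a kernel element and `T_{g^{2ᵏ}}(hodgeSpan) ⊆ L`.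

## References
* [Pohlmann1968] H. Pohlmann, Algebraic cycles on abelian varieties of complex multiplication type, Ann. of Math. 88 (1968), Thm 1.
-/

namespace Summit.HodgeConjecture.CorCM.Census.CyclicCharacter

open Finset
open Summit.HodgeConjecture.CorCM.Prior.AllgGroup.RfwfAllgGroup
open Summit.HodgeConjecture.CorCM.Census.BlockParity
open Summit.HodgeConjecture.CorCM.Census.Coinvariant
open Summit.HodgeConjecture.CorCM.Census.TwistGeneration
open Summit.HodgeConjecture.CorCM.Census.Nondegenerate
open Summit.HodgeConjecture.CorCM.Census.BaseBlock
open Summit.HodgeConjecture.CorCM.Census.OddIndex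

noncomputable section

variable {G : Type*} [Group G] [Fintype G] [DecidableEq G] {k : ℕ} {w : G → ZMod (2 ^ k)} {c : G}

/-! ## §1 `K` is fixed by the kernel -/

/-- **`K·ν⁻¹ = K` for a kernel element `ν`.** [folklore] -/
theorem mapDomain_rt_fibreConst (hw : ∀ P Q : G, w (P * Q) = w P + w Q) (hk : 1 ≤ k) (hc2 : c * c = 1) (hwc : w c ≠ 0) {ν : G} (hν : w ν = 0) :
    Finsupp.mapDomain (rt c ν) (Finsupp.single (arcType hw hk hc2 hwc 0) (1 : ℤ) - Finsupp.single (arcType hw hk hc2 hwc 1) 1 -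
      ∑ s ∈ (univ.filter fun s : G => w s = 0),
        (Finsupp.single (oflipCM c hc2 s (arcType hw hk hc2 hwc 1)) (1 : ℤ) - Finsupp.single (arcType hw hk hc2 hwc 1) 1)) =
    Finsupp.single (arcType hw hk hc2 hwc 0) (1 : ℤ) - Finsupp.single (arcType hw hk hc2 hwc 1) 1 -
      ∑ s ∈ (univ.filter fun s : G => w s = 0),
        (Finsupp.single (oflipCM c hc2 s (arcType hw hk hc2 hwc 1)) (1 : ℤ) - Finsupp.single (arcType hw hk hc2 hwc 1) 1) := by
  simp only [Finsupp.mapDomain_sub, Finsupp.mapDomain_finsetSum, Finsupp.mapDomain_single, rt_oflipCM, rt_arcType, hν, sub_zero]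
  congr 1
  -- reindex the fibre by `s ↦ s ν⁻¹`
  refine Finset.sum_nbij' (fun s => s * ν⁻¹) (fun s => s * ν) ?_ ?_ (fun s _ => inv_mul_cancel_right s ν)
    (fun s _ => mul_inv_cancel_right s ν) (fun s _ => rfl)
  · intro s hs
    simp only [mem_filter, mem_univ, true_and] at hs ⊢
    rw [hw, map_inv hw, hs, hν, neg_zero, add_zero]
  · intro s hs
    simp only [mem_filter, mem_univ, true_and] at hs ⊢
    rw [hw, hs, hν, add_zero]

/-! ## §2 The closing theorem -/

/-- **ζ CLOSES THE HODGE LATTICE MODULO DOUBLING** (`k = 2`, `d = 0`, `|F_0|` even): see the file header. [folklore] -/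
theorem hodgeSpan_le_of_zeta_of_two_smul [Fintype (CMF G c)] (hw : ∀ P Q : G, w (P * Q) = w P + w Q) (hk : 1 ≤ k) (hk2 : k = 2)
    (hc2 : c * c = 1) (hcen : ∀ x : G, x * c = c * x) (hwc : w c ≠ 0) (h1 : ∃ g₁ : G, w g₁ = 1)
    (hnon : ∃ g : G, ¬ 2 ∣ (w g).val ∧ c ∉ Subgroup.zpowers g) (hev : Even (univ.filter fun s : G => w s = 0).card)
    (S : Finset (CMF G c →₀ ℤ)) (hS : (↑S : Set (CMF G c →₀ ℤ)) ⊆ hodgeSpan c hc2)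
    (hcov : ∀ Φ : CMF G c, Finsupp.single Φ (1 : ℤ) ∈
      (Submodule.span ℤ (pairSet c) ⊔ Submodule.span ℤ (translates c S)) ⊔
        Submodule.span ℤ ((fun Ψ => Finsupp.single Ψ (1 : ℤ)) '' {Ψ : CMF G c | bpot c (arcType hw hk hc2 hwc 0) Ψ ≤ 1}))
    (hζ : ∀ s : G, w s = 0 →
      (Finsupp.single (oflipCM c hc2 s (arcType hw hk hc2 hwc 0)) (1 : ℤ) - Finsupp.single (arcType hw hk hc2 hwc 0) 1) +
        (Finsupp.single (oflipCM c hc2 s (arcType hw hk hc2 hwc 1)) (1 : ℤ) - Finsupp.single (arcType hw hk hc2 hwc 1) 1) ∈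
          Submodule.span ℤ (pairSet c) ⊔ Submodule.span ℤ (translates c S))
    (h2 : ∀ y ∈ hodgeSpan c hc2, (2 : ℤ) • y ∈ Submodule.span ℤ (pairSet c) ⊔ Submodule.span ℤ (translates c S)) :
    hodgeSpan c hc2 ≤ Submodule.span ℤ (pairSet c) ⊔ Submodule.span ℤ (translates c S) := by
  have hk' : 2 ≤ k := by omega
  set V := Submodule.span ℤ (pairSet c) ⊔ Submodule.span ℤ (translates c S) with hV
  set H := hodgeSpan c hc2 with hH
  set K : CMF G c →₀ ℤ := Finsupp.single (arcType hw hk hc2 hwc 0) (1 : ℤ) - Finsupp.single (arcType hw hk hc2 hwc 1) 1 -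
      ∑ s ∈ (univ.filter fun s : G => w s = 0),
        (Finsupp.single (oflipCM c hc2 s (arcType hw hk hc2 hwc 1)) (1 : ℤ) - Finsupp.single (arcType hw hk hc2 hwc 1) 1) with hKdef
  obtain ⟨g, hg⟩ := h1
  have h1' : ∃ g₁ : G, w g₁ = 1 := ⟨g, hg⟩
  -- translations
  have τV : ∀ (Q : G), ∀ y ∈ V, Finsupp.mapDomain (rt c Q) y ∈ V := fun Q y hy => mapDomain_rt_mem_psp c hcen Q S hy
  have τH : ∀ (Q : G), ∀ y ∈ H, Finsupp.mapDomain (rt c Q) y ∈ H := fun Q y hy => mapDomain_rt_mem_hodgeSpan c hc2 hcen Q hy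
  have τmul : ∀ (Q Q' : G) (y : CMF G c →₀ ℤ), Finsupp.mapDomain (rt c (Q * Q')) y = Finsupp.mapDomain (rt c Q) (Finsupp.mapDomain (rt c Q') y) := by
    intro Q Q' y
    rw [← Finsupp.mapDomain_comp]; congr 1; funext Ψ; exact rt_mul c Q Q' Ψ
  have hVH : V ≤ H := psp_le_hodgeSpan c hc2 hcen S hS
  have hKH : K ∈ H := fibreConst_mem_hodgeSpan hw hk hc2 hcen hwc
  have hKν : ∀ ν : G, w ν = 0 → Finsupp.mapDomain (rt c ν) K = K := fun ν hν => mapDomain_rt_fibreConst hw hk hc2 hwc hν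
  -- (1) `H ≤ V + ℤ[G]·K`
  have hHVK : ∀ y ∈ H, ∃ v ∈ V, ∃ t ∈ Submodule.span ℤ (translates c ({K} : Finset (CMF G c →₀ ℤ))), y = v + t := by
    intro y hy
    have hgen := hodgeSpan_le_psp_cover_union hw hk hc2 hcen hwc h1' S hS hcov hy
    obtain ⟨p, hp, z, hz, rfl⟩ := Submodule.mem_sup.mp hgen
    -- every translate of the new generators lies in `V + ℤ[G]K`
    have hW2 : (∑ s ∈ univ.filter (fun s => w s = 0), Finsupp.single (oflipCM c hc2 s (arcType hw hk hc2 hwc 0)) (1 : ℤ)) -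
        Finsupp.single (arcType hw hk hc2 hwc 1) (1 : ℤ) -
          (((univ.filter fun s => w s = 0).card : ℤ) - 1) • Finsupp.single (arcType hw hk hc2 hwc 0) (1 : ℤ) =
        K + ∑ s ∈ univ.filter (fun s => w s = 0),
          ((Finsupp.single (oflipCM c hc2 s (arcType hw hk hc2 hwc 0)) (1 : ℤ) - Finsupp.single (arcType hw hk hc2 hwc 0) 1) +
            (Finsupp.single (oflipCM c hc2 s (arcType hw hk hc2 hwc 1)) (1 : ℤ) - Finsupp.single (arcType hw hk hc2 hwc 1) 1)) := by
      rw [hKdef]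
      simp only [sum_add_distrib, sum_sub_distrib, sum_const, ← Nat.cast_smul_eq_nsmul ℤ, sub_smul, one_smul]
      abel
    have hzmem : z ∈ V ⊔ Submodule.span ℤ (translates c ({K} : Finset (CMF G c →₀ ℤ))) := by
      refine (Submodule.span_le.mpr ?_) hz
      rintro _ ⟨Q, f, hf, rfl⟩
      rw [mem_union, mem_union] at hf
      rcases hf with (hf | hf) | hf
      · exact Submodule.mem_sup_left (Submodule.mem_sup_right (Submodule.subset_span ⟨Q, f, hf, rfl⟩))
      · obtain ⟨s, hs, rfl⟩ := mem_image.mp hf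
        refine Submodule.mem_sup_left (τV Q _ ?_)
        rcases apply_eq_zero_or_eq_top_of_two hw hk hk2 hc2 hwc hs with h0 | htop
        · rw [shift_eq_zero_of_apply_eq_zero hw hk hc2 hwc h0]; exact Submodule.zero_mem _
        · have hs1 : w s = 1 := by rw [htop]; subst hk2; decide
          exact shift_mem_of_zeta_mem hw hk hk2 hc2 hcen hwc S (map_one hw) hs1 (hζ 1 (map_one hw))
      · rw [mem_singleton] at hf
        rw [hf, hW2, Finsupp.mapDomain_add]
        refine Submodule.add_mem _ (Submodule.mem_sup_right (Submodule.subset_span ⟨Q, K, mem_singleton_self _, rfl⟩))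
          (Submodule.mem_sup_left (τV Q _ (Submodule.sum_mem _ fun s hs => hζ s (mem_filter.mp hs).2)))
    obtain ⟨v, hv, t, ht, rfl⟩ := Submodule.mem_sup.mp hzmem
    exact ⟨p + v, Submodule.add_mem _ (Submodule.mem_sup_left hp) hv, t, ht, by abel⟩
  -- (2) kernel coboundaries of Hodge vectors lie in `V`
  have hKfix : ∀ ν : G, w ν = 0 → ∀ t ∈ Submodule.span ℤ (translates c ({K} : Finset (CMF G c →₀ ℤ))), Finsupp.mapDomain (rt c ν) t = t := by
    intro ν hν t ht
    induction ht using Submodule.span_induction with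
    | mem a ha =>
      obtain ⟨Q, f, hf, rfl⟩ := ha
      rw [mem_singleton] at hf
      rw [hf, ← τmul, show ν * Q = Q * (Q⁻¹ * ν * Q) by group, τmul, hKν _ (by rw [hw, hw, map_inv hw, hν]; abel)]
    | zero => simp
    | add a b _ _ ha hb => rw [Finsupp.mapDomain_add, ha, hb]
    | smul n a _ ha => rw [Finsupp.mapDomain_smul, ha]
  have hDN : ∀ ν : G, w ν = 0 → ∀ y ∈ H, Finsupp.mapDomain (rt c ν) y - y ∈ V := by
    intro ν hν y hy
    obtain ⟨v, hv, t, ht, rfl⟩ := hHVK y hy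
    rw [Finsupp.mapDomain_add, hKfix ν hν t ht, add_sub_add_right_eq_sub]
    exact Submodule.sub_mem _ (τV ν v hv) hv
  -- the operator `T = (·)·g⁻¹ − 1` and telescoping along powers of `g`
  set T : (CMF G c →₀ ℤ) →ₗ[ℤ] (CMF G c →₀ ℤ) := Finsupp.lmapDomain ℤ ℤ (rt c g) - LinearMap.id with hT
  have hTapp : ∀ y, T y = Finsupp.mapDomain (rt c g) y - y := fun y => by rw [hT]; rfl
  have hTH : ∀ y ∈ H, T y ∈ H := fun y hy => by rw [hTapp]; exact Submodule.sub_mem _ (τH g y hy) hy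
  have hTV : ∀ y ∈ V, T y ∈ V := fun y hy => by rw [hTapp]; exact Submodule.sub_mem _ (τV g y hy) hy
  have htel : ∀ (i : ℕ), ∀ f ∈ H, ∃ y ∈ H, Finsupp.mapDomain (rt c (g ^ i)) f - f = T y := by
    intro i
    induction i with
    | zero =>
      intro f _
      refine ⟨0, Submodule.zero_mem _, ?_⟩
      rw [pow_zero, map_zero, show rt c (1 : G) = id from funext (rt_one c), Finsupp.mapDomain_id, sub_self]
    | succ i ih =>
      intro f hf
      obtain ⟨y, hy, e⟩ := ih f hf
      refine ⟨Finsupp.mapDomain (rt c (g ^ i)) f + y, Submodule.add_mem _ (τH _ f hf) hy, ?_⟩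
      rw [map_add, ← e, hTapp, pow_succ', τmul]
      abel
  -- a coboundary along any `Q` is a kernel coboundary plus a `T`-value, modulo `V`
  have hcob : ∀ (Q : G), ∀ f ∈ H, ∃ v ∈ V, ∃ y ∈ H, Finsupp.mapDomain (rt c Q) f - f = v + T y := by
    intro Q f hf
    set i := (w Q).val with hi
    have hν : w (Q * (g ^ i)⁻¹) = 0 := by
      rw [hw, map_inv hw, map_pow hw, hg, nsmul_eq_mul, mul_one, hi, ZMod.natCast_zmod_val, add_neg_cancel]
    obtain ⟨y, hy, e⟩ := htel i f hf
    have eQ : Q = (Q * (g ^ i)⁻¹) * g ^ i := by rw [inv_mul_cancel_right]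
    refine ⟨Finsupp.mapDomain (rt c (Q * (g ^ i)⁻¹)) (Finsupp.mapDomain (rt c (g ^ i)) f) - Finsupp.mapDomain (rt c (g ^ i)) f,
      hDN _ hν _ (τH _ f hf), y, hy, ?_⟩
    rw [← e]
    conv_lhs => rw [eQ, τmul]
    abel
  -- (3) `K ∈ V + T(H)`
  have hcobspan : ∀ q ∈ Submodule.span ℤ {v : CMF G c →₀ ℤ | ∃ (Q : G) (f : CMF G c →₀ ℤ), f ∈ gfaceSet G c hc2 ∧
      v = Finsupp.mapDomain (rt c Q) f - f}, ∃ v ∈ V, ∃ y ∈ H, q = v + T y := by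
    intro q hq
    induction hq using Submodule.span_induction with
    | mem x hx =>
      obtain ⟨Q, f, hf, rfl⟩ := hx
      exact hcob Q f (gfaceSet_subset_hodgeSpan c hc2 hf)
    | zero => exact ⟨0, Submodule.zero_mem _, 0, Submodule.zero_mem _, by rw [map_zero, add_zero]⟩
    | add x₁ x₂ _ _ hx₁ hx₂ =>
      obtain ⟨v, hv, a, ha, rfl⟩ := hx₁
      obtain ⟨v', hv', a', ha', rfl⟩ := hx₂
      exact ⟨v + v', Submodule.add_mem _ hv hv', a + a', Submodule.add_mem _ ha ha', by rw [map_add]; abel⟩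
    | smul n x₁ _ hx₁ =>
      obtain ⟨v, hv, a, ha, rfl⟩ := hx₁
      exact ⟨n • v, Submodule.smul_mem _ n hv, n • a, Submodule.smul_mem _ n ha, by rw [map_smul, smul_add]⟩
  have hKVT : ∃ v ∈ V, ∃ y ∈ H, K = v + T y := by
    obtain ⟨p, hp, q, hq, z, hz, hKe⟩ := fibreConst_mem_of_nonroot hw hk hk' hc2 hcen hwc h1' hnon hev
    have hpV : p ∈ V := Submodule.mem_sup_left hp
    obtain ⟨v, hv, y, hy, hqe⟩ := hcobspan q hq
    refine ⟨p + v + (2 : ℤ) • z, Submodule.add_mem _ (Submodule.add_mem _ hpV hv) (h2 z hz), y, hy, ?_⟩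
    rw [hKdef, hKe, hqe]; abel
  -- (4) `H ⊆ V + T(H)`, hence `H ⊆ V + Tⁱ(H)` for every `i`
  have hKspan : ∀ t ∈ Submodule.span ℤ (translates c ({K} : Finset (CMF G c →₀ ℤ))), ∃ v ∈ V, ∃ y' ∈ H, t = v + T y' := by
    intro t ht
    induction ht using Submodule.span_induction with
    | mem x hx =>
      obtain ⟨Q, f, hf, rfl⟩ := hx
      rw [mem_singleton] at hf
      subst hf
      obtain ⟨v₁, hv₁, y₁, hy₁, e₁⟩ := hcob Q K hKH
      obtain ⟨v₂, hv₂, y₂, hy₂, e₂⟩ := hKVT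
      refine ⟨v₁ + v₂, Submodule.add_mem _ hv₁ hv₂, y₁ + y₂, Submodule.add_mem _ hy₁ hy₂, ?_⟩
      have e₃ : Finsupp.mapDomain (rt c Q) K = (Finsupp.mapDomain (rt c Q) K - K) + K := by abel
      rw [map_add, e₃, e₁, e₂]
      abel
    | zero => exact ⟨0, Submodule.zero_mem _, 0, Submodule.zero_mem _, by rw [map_zero, add_zero]⟩
    | add x₁ x₂ _ _ hx₁ hx₂ =>
      obtain ⟨v, hv, a, ha, rfl⟩ := hx₁
      obtain ⟨v', hv', a', ha', rfl⟩ := hx₂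
      exact ⟨v + v', Submodule.add_mem _ hv hv', a + a', Submodule.add_mem _ ha ha', by rw [map_add]; abel⟩
    | smul n x₁ _ hx₁ =>
      obtain ⟨v, hv, a, ha, rfl⟩ := hx₁
      exact ⟨n • v, Submodule.smul_mem _ n hv, n • a, Submodule.smul_mem _ n ha, by rw [map_smul, smul_add]⟩
  have hstep : ∀ y ∈ H, ∃ v ∈ V, ∃ y' ∈ H, y = v + T y' := by
    intro y hy
    obtain ⟨v, hv, t, ht, rfl⟩ := hHVK y hy
    obtain ⟨v', hv', y', hy', rfl⟩ := hKspan t ht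
    exact ⟨v + v', Submodule.add_mem _ hv hv', y', hy', by abel⟩
  have hTpowV : ∀ (i : ℕ), ∀ v ∈ V, (T ^ i) v ∈ V := by
    intro i; induction i with
    | zero => intro v hv; simpa using hv
    | succ i ih => intro v hv; rw [pow_succ', Module.End.mul_apply]; exact hTV _ (ih v hv)
  have hTpowH : ∀ (i : ℕ), ∀ v ∈ H, (T ^ i) v ∈ H := by
    intro i; induction i with
    | zero => intro v hv; simpa using hv
    | succ i ih => intro v hv; rw [pow_succ', Module.End.mul_apply]; exact hTH _ (ih v hv)
  have hiter : ∀ (i : ℕ), ∀ y ∈ H, ∃ v ∈ V, ∃ y' ∈ H, y = v + (T ^ i) y' := by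
    intro i
    induction i with
    | zero => intro y hy; exact ⟨0, Submodule.zero_mem _, y, hy, by simp⟩
    | succ i ih =>
      intro y hy
      obtain ⟨v, hv, y₁, hy₁, rfl⟩ := ih y hy
      obtain ⟨v₂, hv₂, y₂, hy₂, rfl⟩ := hstep y₁ hy₁
      refine ⟨v + (T ^ i) v₂, Submodule.add_mem _ hv (hTpowV i v₂ hv₂), y₂, hy₂, ?_⟩
      rw [map_add, pow_succ, Module.End.mul_apply]; abel
  -- (5) `T^{2^j} ≡ T_{g^{2^j}}` modulo `V`
  have hpow : ∀ (j : ℕ), ∀ y ∈ H, ∃ v ∈ V, ∃ y' ∈ H, (T ^ (2 ^ j)) y = v + (Finsupp.mapDomain (rt c (g ^ (2 ^ j))) y' - y') := by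
    intro j
    induction j with
    | zero => intro y hy; exact ⟨0, Submodule.zero_mem _, y, hy, by rw [pow_zero, pow_one, pow_one, zero_add, hTapp]⟩
    | succ j ih =>
      intro y hy
      set u := g ^ (2 ^ j) with hu
      -- `T` commutes with the translation by `u`
      have hcomm : ∀ z, (T ^ (2 ^ j)) (Finsupp.mapDomain (rt c u) z - z) = Finsupp.mapDomain (rt c u) ((T ^ (2 ^ j)) z) - (T ^ (2 ^ j)) z := by
        have hc1 : ∀ z, T (Finsupp.mapDomain (rt c u) z) = Finsupp.mapDomain (rt c u) (T z) := by
          intro z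
          rw [hTapp, hTapp, Finsupp.mapDomain_sub, ← τmul, ← τmul, hu, ← pow_succ, ← pow_succ']
        have hcn : ∀ (n : ℕ) z, (T ^ n) (Finsupp.mapDomain (rt c u) z) = Finsupp.mapDomain (rt c u) ((T ^ n) z) := by
          intro n; induction n with
          | zero => intro z; simp
          | succ n ihn => intro z; rw [pow_succ', Module.End.mul_apply, Module.End.mul_apply, ihn, hc1]
        intro z; rw [map_sub, hcn]
      obtain ⟨v₁, hv₁, y₁, hy₁, e₁⟩ := ih y hy
      obtain ⟨v₂, hv₂, y₂, hy₂, e₂⟩ := ih y₁ hy₁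
      have hsq : Finsupp.mapDomain (rt c u) v₂ + Finsupp.mapDomain (rt c u) (Finsupp.mapDomain (rt c u) y₂ - y₂) - (v₂ + (Finsupp.mapDomain (rt c u) y₂ - y₂)) =
          (Finsupp.mapDomain (rt c u) v₂ - v₂) - (2 : ℤ) • (Finsupp.mapDomain (rt c u) y₂ - y₂) +
            (Finsupp.mapDomain (rt c (g ^ (2 ^ j * 2))) y₂ - y₂) := by
        rw [Finsupp.mapDomain_sub, ← τmul, hu, ← pow_add, ← mul_two, two_smul]
        abel
      refine ⟨(T ^ (2 ^ j)) v₁ + (Finsupp.mapDomain (rt c u) v₂ - v₂) - (2 : ℤ) • (Finsupp.mapDomain (rt c u) y₂ - y₂), ?_, y₂, hy₂, ?_⟩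
      · refine Submodule.sub_mem _ (Submodule.add_mem _ (hTpowV _ v₁ hv₁) (Submodule.sub_mem _ (τV u v₂ hv₂) hv₂)) ?_
        exact h2 _ (Submodule.sub_mem _ (τH u y₂ hy₂) hy₂)
      · rw [pow_succ, pow_mul, pow_two, Module.End.mul_apply, e₁, map_add, hcomm, e₂, Finsupp.mapDomain_add, hsq]
        abel
  -- conclusion: at `j = k`, `g^{2^k}` lies in the kernel
  intro y hy
  obtain ⟨v, hv, y₁, hy₁, rfl⟩ := hiter (2 ^ k) y hy
  obtain ⟨v', hv', y₂, hy₂, e⟩ := hpow k y₁ hy₁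
  have hνk : w (g ^ (2 ^ k)) = 0 := by
    haveI : NeZero (2 ^ k) := ⟨pow_ne_zero _ two_ne_zero⟩
    rw [map_pow hw, hg, nsmul_eq_mul, mul_one, ZMod.natCast_self]
  rw [e]
  exact Submodule.add_mem _ hv (Submodule.add_mem _ hv' (hDN _ hνk y₂ hy₂))

/-- **THE `d = 0` LAW FOR `k = 2` MODULO DOUBLING.**  For `w ↠ ℤ/4`, `w c ≠ 0`, kernel of EVEN size `2m ≥ 4` and `d = 0`: there is a face family `S₀` with
`|S₀| ≤ φ₂(G, c)` (part XXXIʼs ζ-certificate; `φ₂ + 2 = β`) such that **`2·hodgeSpan ⊆ ℤ⟨pairs⟩ + ℤ[G]·S₀ ⟹ hodgeSpan ≤ ℤ⟨pairs⟩ + ℤ[G]·S₀`** — and then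
`μ(G, c) = φ₂(G, c)` by the floor.  The doubling hypothesis is OPEN (numerically true in every row). [folklore] -/
theorem exists_zetaCert_closing_of_two [Fintype (CMF G c)] (hw : ∀ P Q : G, w (P * Q) = w P + w Q) (hk : 1 ≤ k) (hk2 : k = 2)
    (hc2 : c * c = 1) (hcen : ∀ x : G, x * c = c * x) (hwc : w c ≠ 0) (h1 : ∃ g₁ : G, w g₁ = 1)
    (hnon : ∃ g : G, ¬ 2 ∣ (w g).val ∧ c ∉ Subgroup.zpowers g)
    {m : ℕ} (hm : 2 * m = (univ.filter fun s : G => w s = 0).card) (hm2 : 2 ≤ m) :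
    ∃ S₀ : Finset (CMF G c →₀ ℤ), (↑S₀ ⊆ gfaceSet G c hc2) ∧ S₀.card ≤ fibreTwo c hc2 ∧
      ((∀ y ∈ hodgeSpan c hc2, (2 : ℤ) • y ∈ Submodule.span ℤ (pairSet c) ⊔ Submodule.span ℤ (translates c S₀)) →
        hodgeSpan c hc2 ≤ Submodule.span ℤ (pairSet c) ⊔ Submodule.span ℤ (translates c S₀) ∧
        IsLeast {n : ℕ | ∃ S : Finset (CMF G c →₀ ℤ), (↑S ⊆ gfaceSet G c hc2) ∧ S.card = n ∧
          hodgeSpan c hc2 ≤ Submodule.span ℤ (pairSet c) ⊔ Submodule.span ℤ (translates c S)} (fibreTwo c hc2)) := by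
  have hk' : 2 ≤ k := by omega
  have hβ := fibreTwo_add_two_eq_card_block hw hk' h1 hc2 hcen hwc hnon
  obtain ⟨S₀, hS₀f, hcard, htw, hζ⟩ := exists_zetaCert hw hk hk' hc2 hcen hwc h1 hm hm2
  have hcardφ : S₀.card ≤ fibreTwo c hc2 := by
    have h2k : 2 ^ (k - 1) = 2 := by rw [hk2]; norm_num
    rw [h2k] at hcard; omega
  refine ⟨S₀, hS₀f, hcardφ, fun h2 => ?_⟩
  have hev : Even (univ.filter fun s : G => w s = 0).card := ⟨m, by omega⟩
  have hgen := hodgeSpan_le_of_zeta_of_two_smul hw hk hk2 hc2 hcen hwc h1 hnon hev S₀ (hS₀f.trans (gfaceSet_subset_hodgeSpan c hc2))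
    (fun Φ => hcov_of_toward c (arcType hw hk hc2 hwc 0) hc2 S₀ htw Φ) hζ h2
  have hge : fibreTwo c hc2 ≤ S₀.card :=
    fibreTwo_le_card_of_faces c hc2 hcen S₀ hS₀f fun y hy => hgen (gfaceSet_subset_hodgeSpan c hc2 hy)
  have hcardEq : S₀.card = fibreTwo c hc2 := le_antisymm hcardφ hge
  refine ⟨hgen, ⟨S₀, hS₀f, hcardEq, hgen⟩, ?_⟩
  rintro n ⟨S, hS, rfl, hgen'⟩
  exact fibreTwo_le_card_of_faces c hc2 hcen S hS fun y hy => hgen' (gfaceSet_subset_hodgeSpan c hc2 hy)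

end

end Summit.HodgeConjecture.CorCM.Census.CyclicCharacter
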